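import Mathlib
import Summits.ValiantsHypothesis.ValiantsHypothesis.Theorems.BarrierLeverSuccinctHittingSetsForVPSeparableCoeffThree
import Summits.ValiantsHypothesis.ValiantsHypothesis.Theorems.BarrierLeverSuccinctHittingSetsForVPStubReadOnceHit
import HarnessLib

/-!
# Read-once (PROP) distinguishers are hit by `SmallCircuits ℂ n 5` (crux stmt-ValiantsHypothesis-14610
side; docket 8745/8749 of seat val-np-p5)

**What is proved (unconditional; it does NOT close any item).** The tree's `stub_readOnceHit`
(line `birth`, wave 10): eventually in `n`, `SmallCircuits ℂ n 10` hits every nonzero polynomial in the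
`N = C(2n,n)` coefficient variables computed by a preprocessed read-once formula (`IsPROP`). Its
exponent `10` is the cost of realising the `4n` seed polynomials of the succinct Shpilka–Volkovich
generator by `stub_separableCoeff` (exponent `8`). With `SeparableCoeffThree.separableCoeff_three`
(exponent `3`) the same proof gives exponent `5` (`readOnceHit_five`; budget
`n³ + (4n(n³+1) + 4n) + 1 ≤ n⁵`, `ReadOnceFive.size_budget_five`), hence no read-once-formula natural
proof against `SmallCircuits ℂ n b` for any `b ≥ 5` (`not_isNaturalProof_prop_five`). The seed count
`4n` (from `C(2n,n) < 2^{4n}`) is what keeps the exponent at `5`; `2n + 1` seeds would not change it.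

Honest framing: 14610-side bookkeeping (chart row 'read-once / PROP distinguishers': 10 → 5); the
8749-side door 'E a poly(N)-size read-once formula in the c's' stays OPEN at b = 2, 3, 4; nothing
here bears on `VP ≠ VNP`.

References: [ShpilkaVolkovich2015] Thm. 1; [MinahanVolkovich2017] Def. 12; [ForbesShpilkaVolk2018]
§3, Construction 25/29, Question 6.
-/

-- layout Summits/ValiantsHypothesis/ValiantsHypothesis forces the duplicated namespace component
set_option linter.dupNamespace false

noncomputable section

namespace Summit.ValiantsHypothesis.ValiantsHypothesis.Theorems.BarrierLever.SuccinctHittingSetsForVP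

open Literature.Barriers.ValiantsHypothesis Literature.Computability.AlgebraicComplexity MvPolynomial

namespace ReadOnceFive

/-- The size budget of the realisation at exponent 3 pieces: for `n ≥ 5`,
`n³ + (4n(n³ + 1) + 4n) + 1 ≤ n⁵`. [folklore] -/
theorem size_budget_five {n : ℕ} (hn : 5 ≤ n) :
    n ^ 3 + (2 * 2 * n * (n ^ 3 + 1) + 2 * 2 * n) + 1 ≤ n ^ 5 := by
  obtain ⟨m, rfl⟩ : ∃ m, n = m + 5 := ⟨n - 5, by omega⟩
  ring_nf
  nlinarith [sq_nonneg m, sq_nonneg (m * m), Nat.zero_le m, Nat.zero_le (m * m * m),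
    Nat.zero_le (m * m * m * m)]

end ReadOnceFive

/-- **Read-once (PROP) distinguishers are hit by `SmallCircuits ℂ n 5`** (tree: `stub_readOnceHit`,
exponent `10`): for all `n ≥ 24`, the coefficient vectors of `SmallCircuits ℂ n 5` hit every nonzero
polynomial in the `N = C(2n,n)` coefficient variables computed by a preprocessed read-once formula
(`IsPROP`; any size, any degree). Verbatim the tree's proof (succinct Shpilka–Volkovich generator with
`4n` seeds, `stub_readOnceGenerator`, the generator principle) with the seed polynomials realised at
exponent `3` by `SeparableCoeffThree.separableCoeff_three` instead of `stub_separableCoeff`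
(exponent `8`), and the budget `n³ + (4n(n³+1) + 4n) + 1 ≤ n⁵`.
[cite: ForbesShpilkaVolk2018, §3 and Construction 29] [cite: ShpilkaVolkovich2015, Thm. 1] -/
theorem readOnceHit_five :
    ∃ n₀ : ℕ, ∀ n : ℕ, n₀ ≤ n → IsSuccinctHittingSet (degLEMonomials n) (SmallCircuits ℂ n 5)
      {D | ∃ S : Finset (degLEMonomials n), IsPROP S D} := by
  -- adapted from the tree's `stub_readOnceHit` (exponent 10)
  refine ⟨24, fun n hn D hD hD0 => ?_⟩
  obtain ⟨S, hS⟩ := hD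
  obtain ⟨ℓ, hℓ⟩ := stub_lagrangeIndicator n
  obtain ⟨f₀, hf₀, -⟩ := stub_fullSupport n (by omega)
  haveI : Fintype (degLEMonomials n) := (GKSS2017.degLEMonomials_finite n).fintype
  have hcard : Fintype.card (degLEMonomials n) < 2 ^ (2 * 2 * n) := by
    rw [← Nat.card_eq_fintype_card, GKSS2017.card_degLEMonomials]
    calc (2 * n).choose n ≤ 2 ^ (2 * n) := Nat.choose_le_two_pow _ _
      _ < 2 ^ (2 * 2 * n) := Nat.pow_lt_pow_right (by norm_num) (by omega)
  have hgen := stub_readOnceGenerator (degLEMonomials n) (Fin n) (2 * 2 * n)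
    (fun μ => ∏ i : Fin n, Polynomial.aeval (X i : MvPolynomial (Fin n) ℂ) (ℓ ((μ : Fin n →₀ ℕ) i)))
    (fun ν i => (((ν : Fin n →₀ ℕ) i : ℕ) : ℂ)) (GeneratorGlue.eval_indicator hℓ) hcard
    (fun μ => coeff (μ : Fin n →₀ ℕ) f₀) D S hS hD0
  refine Generator.exists_mem_smallCircuits_of_aeval_ne_zero (fun p => ?_) hgen
  choose Λ hΛmem hΛcoeff using fun j : Fin (2 * 2 * n) =>
    SeparableCoeffThree.separableCoeff_three n (by omega)
      (fun i k => (ℓ k).eval (p (Sum.inr (j, i))))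
  refine ⟨f₀ + ∑ j : Fin (2 * 2 * n), C (p (Sum.inl j)) * Λ j,
    GeneratorGlue.add_sum_mem_smallCircuits (ReadOnceFive.size_budget_five (by omega)) hf₀
      hΛmem _, fun μ => ?_⟩
  rw [GeneratorGlue.coeff_add_sum, GeneratorGlue.eval_generator]
  simp only [GeneratorGlue.eval_prod_aeval, hΛcoeff]

/-- **No read-once-formula natural proof against `SmallCircuits ℂ n 5`** (`n ≥ 24`): a nonzero
PROP in the coefficient variables is nonzero at some member. [cite: ForbesShpilkaVolk2018, Thm. 4] -/
theorem not_isNaturalProof_prop_five :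
    ∃ n₀ : ℕ, ∀ n : ℕ, n₀ ≤ n → ∀ b : ℕ, 5 ≤ b →
      ∀ (𝒟 : Set (MvPolynomial (degLEMonomials n) ℂ)) (D : MvPolynomial (degLEMonomials n) ℂ)
        (S : Finset (degLEMonomials n)), IsPROP S D →
        ¬ IsNaturalProof (degLEMonomials n) (SmallCircuits ℂ n b) 𝒟 D := by
  obtain ⟨n₀, h⟩ := readOnceHit_five
  refine ⟨max n₀ 1, fun n hn b hb 𝒟 D S hS hnat => ?_⟩
  obtain ⟨-, hD0, hvan⟩ := hnat
  obtain ⟨f, hf, hne⟩ := h n (le_of_max_le_left hn) D ⟨S, hS⟩ hD0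
  exact hne (hvan f (smallCircuits_mono ℂ hb (le_of_max_le_right hn) hf))

end Summit.ValiantsHypothesis.ValiantsHypothesis.Theorems.BarrierLever.SuccinctHittingSetsForVP

end
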